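import Mathlib
import Literature.AlgebraicGeometry.CossartPiltant200819.Thm15iBaseSidePhase2019
import Literature.AlgebraicGeometry.Resolution.LocalBlowup
import Literature.AlgebraicGeometry.Resolution.QuadraticTransforms
import Summits.ResolutionOfSingularities.ResolutionOfSingularities.Theorems.RadicialJungCleanModelsLens5PRankTwoCurrency
import Summits.ResolutionOfSingularities.ResolutionOfSingularities.Theorems.RadicialJungCleanModelsConeExit
import Summits.ResolutionOfSingularities.ResolutionOfSingularities.Theorems.RadicialJungCleanModelsConeExitSmooth
import HarnessLib

/-!
# Route `RadicialJung`, crux `CleanModels` (stmt-15917), line `Sketch`: the dim-3 residual at EVERY prime after the printed phase, in ONE declaration — clean, or a return through a singular point of a SINGULAR tangent cone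

Line lead `res-B-lead-1` g10, `--supports stmt-ResolutionOfSingularities-15917`.  The general-`p` twin of ✓ `ConeExit.cleanLUConcl_or_degenerateReturn_three`:
assembly of ✓ `ConeExit.cleanLUConcl_or_firstReturn_of_baseSidePhaseAt` (every `p`, mod wi-91399 `CossartPiltant2019_thm_1_5_i_baseSidePhase`) and ✓
`ConeExit.cleanLUConcl_of_smoothCone` (the smooth-cone exit).  For EVERY valuation ring `O` with a 3-dimensional regular finitely generated centre and every
`g₀ ∉ K^p`: EITHER `CleanLUConcl p k K O A g₀`, OR there is an END stage `R' = locAtCentre A' O` of the printed phase with a representative `h ∈ 𝔪^e` of the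
`K^p`-line, `2 ≤ e ≤ p − 1` its intrinsic order (`h - c'^p ∉ 𝔪^{e+1}` for all `c'`), whose tangent cone is SINGULAR in the sense that NO homogeneous `F` of a
degree `e'` prime to `p` with `h ≡ F(t) (mod 𝔪^{e'+1})` in any regular system of parameters `t` satisfies the lifted Jacobian smoothness condition, AND the centre of
`O` on the quadratic transform is a singular point of the cone (`h = x^e G`, `G ∈ 𝔪₁² + (x)`).  This is the registered research residual of Sketch rev 35 read
after the printed phase, in one citable statement.

Honest framing: OURS · counted 0 · a dichotomy, not a termination statement; nothing here proves resolution in characteristic `p`.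
-/

noncomputable section

set_option linter.dupNamespace false

open IsLocalRing
open Literature.AlgebraicGeometry.Resolution
open Literature.AlgebraicGeometry.CossartPiltant200819
open Summit.ResolutionOfSingularities.ResolutionOfSingularities.Theorems.RadicialJung.CleanModels.Lens5.PRankTwoCurrency

namespace Summit.ResolutionOfSingularities.ResolutionOfSingularities.Theorems.RadicialJung.CleanModels.ConeExit

/-- **The dim-3 residual after the printed phase, every prime: CLEAN, or a return through a singular point of a SINGULAR tangent cone.**  See the module docstring;
from the printed fact `CossartPiltant2019_thm_1_5_i_baseSidePhase` BY NAME. [cite: CossartPiltant2019, Thm. 1.5 (i) pp. 271–272; Cor. 5.6 p. 405; Prop. 2.22 pp. 294–295] -/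
theorem cleanLUConcl_or_singularConeReturn (hBS : CossartPiltant2019_thm_1_5_i_baseSidePhase.{0}) (p : ℕ) (hp : p.Prime)
    (k : Type) [Field k] [CharP k p] (K : Type) [Field K] [Algebra k K]
    (O : ValuationSubring K) (A : Subalgebra k K) (hAO : A.toSubring ≤ O.toSubring) (hAfg : A.FG)
    (hfrac : IsFractionRing A K) (hreg : IsRegularLocalRing (locAtCentre A.toSubring O))
    (hdim3 : ringKrullDim (locAtCentre A.toSubring O) = 3) (g₀ : K) (hg₀ : ∀ c : K, c ^ p ≠ g₀) :
    CleanLUConcl p k K O A g₀ ∨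
    ∃ (A' : Subalgebra k K) (_ : A'.toSubring ≤ O.toSubring) (_ : A ≤ A') (_ : A'.FG)
      (_ : IsRegularLocalRing (locAtCentre A'.toSubring O))
      (c : Fin p → K) (h : locAtCentre A'.toSubring O) (e : ℕ),
      (∃ j : Fin p, (j : ℕ) ≠ 0 ∧ c j ≠ 0) ∧ (∑ j : Fin p, c j ^ p * g₀ ^ (j : ℕ)) = (h : K) ∧ 2 ≤ e ∧ e < p ∧
      h ∈ maximalIdeal (locAtCentre A'.toSubring O) ^ e ∧
      (∀ c' : locAtCentre A'.toSubring O, h - c' ^ p ∉ maximalIdeal (locAtCentre A'.toSubring O) ^ (e + 1)) ∧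
      -- SINGULARITY of the tangent cone: no smooth homogeneous writing of any degree prime to `p`, in any regular system of parameters
      (∀ (d : ℕ), 0 < d → (maximalIdeal (locAtCentre A'.toSubring O)).spanFinrank = d →
        ∀ (t : Fin d → locAtCentre A'.toSubring O), Ideal.span (Set.range t) = maximalIdeal (locAtCentre A'.toSubring O) →
        ∀ (F : MvPolynomial (Fin d) (locAtCentre A'.toSubring O)) (e' N : ℕ), F.IsHomogeneous e' → ¬ p ∣ e' → e' ≤ N + 1 →
          h - MvPolynomial.aeval t F ∈ maximalIdeal (locAtCentre A'.toSubring O) ^ (e' + 1) →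
          ∃ i, ∀ b : Fin d → locAtCentre A'.toSubring O,
            (∀ l, b l ∈ maximalIdeal (locAtCentre A'.toSubring O) ^ (N + 1 - e')) →
            t i ^ N - ∑ l, b l * MvPolynomial.aeval t (MvPolynomial.pderiv l F) ∉
              maximalIdeal (locAtCentre A'.toSubring O) ^ (N + 1)) ∧
      -- the RETURN
      ∃ (A'' : Subalgebra k K) (_ : A''.toSubring ≤ O.toSubring) (_ : A' ≤ A'') (_ : A''.FG)
        (_ : IsQuadraticTransformAlong O (locAtCentre A'.toSubring O) (locAtCentre A''.toSubring O))
        (_ : IsRegularLocalRing (locAtCentre A''.toSubring O))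
        (x : locAtCentre A'.toSubring O) (hxR₁ : (x : K) ∈ locAtCentre A''.toSubring O) (G : locAtCentre A''.toSubring O),
        x ∈ maximalIdeal (locAtCentre A'.toSubring O) ∧ (x : K) ≠ 0 ∧
        (∀ y ∈ maximalIdeal (locAtCentre A'.toSubring O), O.valuation (y : K) ≤ O.valuation (x : K)) ∧
        (⟨(x : K), hxR₁⟩ : locAtCentre A''.toSubring O) ∈ maximalIdeal (locAtCentre A''.toSubring O) ∧
        (⟨(x : K), hxR₁⟩ : locAtCentre A''.toSubring O) ∉ maximalIdeal (locAtCentre A''.toSubring O) ^ 2 ∧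
        (h : K) = (x : K) ^ e * (G : K) ∧
        G ∈ maximalIdeal (locAtCentre A''.toSubring O) ^ 2 ⊔ Ideal.span {(⟨(x : K), hxR₁⟩ : locAtCentre A''.toSubring O)} := by
  classical
  rcases cleanLUConcl_or_firstReturn_of_cp2019BaseSidePhase hBS p hp k K O A hAO hAfg hfrac hreg hdim3 g₀ hg₀ with hclean | hret
  · exact Or.inl hclean
  · obtain ⟨A', hA'O, hAA', hA'fg, hregA', c, h, e, hc0, hc, he2, hep, hhe, hmax, A'', hA''O, hA'A'', hA''fg, hq, hreg₁, x, hxR₁, G,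
      hx, hx0, hmin, hxm₁, hx2₁, hG, hGt⟩ := hret
    by_cases hS : ∃ (d : ℕ) (_ : 0 < d) (_ : (maximalIdeal (locAtCentre A'.toSubring O)).spanFinrank = d)
        (t : Fin d → locAtCentre A'.toSubring O) (_ : Ideal.span (Set.range t) = maximalIdeal (locAtCentre A'.toSubring O))
        (F : MvPolynomial (Fin d) (locAtCentre A'.toSubring O)) (e' N : ℕ) (_ : F.IsHomogeneous e') (_ : ¬ p ∣ e') (_ : e' ≤ N + 1),
        h - MvPolynomial.aeval t F ∈ maximalIdeal (locAtCentre A'.toSubring O) ^ (e' + 1) ∧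
        ∀ i, ∃ b : Fin d → locAtCentre A'.toSubring O,
          (∀ l, b l ∈ maximalIdeal (locAtCentre A'.toSubring O) ^ (N + 1 - e')) ∧
          t i ^ N - ∑ l, b l * MvPolynomial.aeval t (MvPolynomial.pderiv l F) ∈ maximalIdeal (locAtCentre A'.toSubring O) ^ (N + 1)
    · obtain ⟨d, hd0, hd, t, ht, F, e', N, hF, hpe, hN, hQ, hsm⟩ := hS
      exact Or.inl (cleanLUConcl_of_smoothCone hp O A A' hA'O hAA' hA'fg hregA' g₀ c hc0 h hc hd0 hd t ht F hF hpe hQ hN hsm)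
    · push Not at hS
      refine Or.inr ⟨A', hA'O, hAA', hA'fg, hregA', c, h, e, hc0, hc, he2, hep, hhe, hmax, ?_, A'', hA''O, hA'A'', hA''fg, hq, hreg₁, x, hxR₁, G,
        hx, hx0, hmin, hxm₁, hx2₁, hG, hGt⟩
      intro d hd0 hd t ht F e' N hF hpe hN hQ
      exact hS d hd0 hd t ht F e' N hF hpe hN hQ

end Summit.ResolutionOfSingularities.ResolutionOfSingularities.Theorems.RadicialJung.CleanModels.ConeExit

end
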